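import Mathlib
import Summits.HubbardSuperconductivity.HubbardSuperconductivity.Theorems.NodalWardXYVisonPairCostSymbolDefs
import Summits.HubbardSuperconductivity.HubbardSuperconductivity.Theorems.NodalWardXYNodalPropagatorDecayGeometry

/-!
# Crux `NodalWardXY.VisonPairCost` (stmt-HubbardSuperconductivity-1266), line `Sketch`:
# the grid-sum bounds `stub_gridSumBounds : GridSumBounds`

Statement (S-3) of `…VisonPairCostSymbolDefs`: for `μ ∈ (−4,4)`, `Δ₀ > 0`, `t₀ ≥ 1` there is `C ≥ 0` with
`(1/L) Σ_{j<L} 1/ε(2πj/L) ≤ C (1 + |log t|)` and `(1/L) Σ_{j<L} 1/ε(2πj/L)² ≤ C/t` for all `L ≥ 4` and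
`t ∈ [1/L, t₀]`, where `ε(k) = lineEps μ Δ₀ t k = √(coneSq Δ₀ (cos k + μ/4)² + t²)` — a Riemann sum over the
momentum grid of a function with two spikes of height `1/t` and width `∝ t` at the nodes `k = n₀, 2π − n₀`,
`n₀ = arccos(−μ/4) ∈ (0, π)`.

Proof (elementary; no integrals are needed):
* cone bound (`NodalDecay.abs_cos_sub_cos_ge`): `|cos θ − cos n₀| ≥ κ ||θ| − n₀|` on `|θ| ≤ π`; with
  `a = 2 min(1,Δ₀) κ` (`a² ≤ coneSq κ²`) this gives, for a grid point `θ_j = hj ∈ [0, 2π)` (`h = 2π/L`),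
  `ε(θ_j)² ≥ a²(hj − n₀)² + t²` if `hj ≤ π`, and `ε(θ_j)² ≥ a²(hj − n₁)² + t²` with `n₁ = 2π − n₀`
  if `hj > π` (representative `hj − 2π ∈ (−π, 0)`); hence `1/ε(θ_j) ≤ f(hj − n₀) + f(hj − n₁)` and
  `1/ε(θ_j)² ≤ g(hj − n₀) + g(hj − n₁)` with `f(u) = 1/√(a²u² + t²)`, `g(u) = 1/(a²u² + t²)`;
* shifted grid sums (`gs_sum_shift_le`): for `F ≥ 0` radially non-increasing and a centre `x₀ ∈ [0, hL)`,
  `Σ_{j<L} F(hj − x₀) ≤ 2 Σ_{k<L} F(hk)` (re-index the grid points right of `x₀` from `⌊x₀/h⌋ + 1` and those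
  left of `x₀` from `⌊x₀/h⌋`; both re-indexings are injective into `{0,…,L−1}` and do not increase the
  distance to the centre);
* telescoping (`gs_sum_inv_sqrt_le`, `gs_sum_inv_sq_le`): `h f(hk) ≤ (2/a)(log(ahk + t) − log(ah(k−1) + t))`
  (from `1/√(p² + t²) ≤ 2/(p + t)` and `log(X/Y) ≥ 1 − Y/X`) and
  `h g(hk) ≤ (2/a)(1/(ah(k−1) + t) − 1/(ahk + t))`, whence
  `h Σ_{k<L} f(hk) ≤ h/t + (2/a)(log(ahL + t) − log t)` and `h Σ_{k<L} g(hk) ≤ h/t² + 2/(at)`;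
* assembly: `1/L = h/(2π)`, `h ≤ 2πt` (from `t ≥ 1/L`), `ahL = 2πa`, `4 ≤ 2π`; both bounds hold with
  `C = 2π + (2/a)(log(2πa + t₀) + 1)`.
References: the crux docstring (`Theses/NodalWardXY.lean`); tree lemma `NodalDecay.abs_cos_sub_cos_ge`
(`…NodalWardXYNodalPropagatorDecayGeometry`); Mathlib `Real.one_sub_inv_le_log_of_pos`,
`Finset.sum_range_sub`, `Fin.sum_univ_eq_sum_range`.  No definition is introduced.
-/

noncomputable section

-- tree namespace Summit.HubbardSuperconductivity.HubbardSuperconductivity (D-0017)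
set_option linter.dupNamespace false

namespace Summit.HubbardSuperconductivity.HubbardSuperconductivity.Theorems.VisonPairCost

open Summit.HubbardSuperconductivity.HubbardSuperconductivity.Theses.NodalWardXY
open Finset

/-! ## Toolkit: re-indexed and telescoping grid sums -/

/-- **Shifted grid sums.** For `F ≥ 0` radially non-increasing (`F v ≤ F u` whenever `0 ≤ u ≤ |v|`), a grid
step `h > 0` and a centre `x₀ ∈ [0, hL)`: `Σ_{j<L} F(hj − x₀) ≤ 2 Σ_{k<L} F(hk)`. [folklore] -/
theorem gs_sum_shift_le (F : ℝ → ℝ) (hF0 : ∀ u, 0 ≤ F u) (hF : ∀ u v, 0 ≤ u → u ≤ |v| → F v ≤ F u)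
    {h x₀ : ℝ} (hh : 0 < h) (hx0 : 0 ≤ x₀) (L : ℕ) (hxL : x₀ < h * L) :
    ∑ j ∈ range L, F (h * j - x₀) ≤ 2 * ∑ k ∈ range L, F (h * k) := by
  set m := ⌊x₀ / h⌋₊ with hm
  have hdiv : 0 ≤ x₀ / h := div_nonneg hx0 hh.le
  have hm1 : h * m ≤ x₀ := by
    have := Nat.floor_le hdiv
    rwa [le_div_iff₀ hh, mul_comm] at this
  have hm2 : x₀ < h * (m + 1) := by
    have := Nat.lt_floor_add_one (x₀ / h)
    rwa [div_lt_iff₀ hh, mul_comm] at this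
  have hmL : m < L := by
    rw [hm, Nat.floor_lt hdiv, div_lt_iff₀ hh, mul_comm]; exact hxL
  -- re-indexing along a map `φ` injective on `S` with values in `range L`
  have key : ∀ (S : Finset ℕ) (φ : ℕ → ℕ), Set.InjOn φ ↑S → (∀ s ∈ S, φ s ∈ range L) →
      (∀ s ∈ S, F (h * s - x₀) ≤ F (h * φ s)) → ∑ s ∈ S, F (h * s - x₀) ≤ ∑ k ∈ range L, F (h * k) := by
    intro S φ hinj hmaps hle
    calc ∑ s ∈ S, F (h * s - x₀) ≤ ∑ s ∈ S, F (h * φ s) := sum_le_sum hle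
      _ = ∑ k ∈ S.image φ, F (h * k) := (sum_image (f := fun k : ℕ => F (h * k)) hinj).symm
      _ ≤ ∑ k ∈ range L, F (h * k) :=
        sum_le_sum_of_subset_of_nonneg (image_subset_iff.2 hmaps) fun k _ _ => hF0 _
  rw [← sum_filter_add_sum_filter_not (range L) (fun j => j ≤ m) (fun j => F (h * j - x₀)), two_mul]
  refine add_le_add ?_ ?_
  · -- grid points left of `x₀` (`j ≤ m`): re-index by `k = m - j`
    refine key _ (fun j => m - j) ?_ ?_ ?_
    · intro j₁ hj₁ j₂ hj₂ he
      simp only [coe_filter, mem_range, Set.mem_setOf_eq] at hj₁ hj₂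
      simp only at he
      omega
    · intro j hj
      simp only [mem_filter, mem_range] at hj ⊢
      omega
    · intro j hj
      simp only [mem_filter, mem_range] at hj
      have hjm : (j : ℝ) ≤ m := by exact_mod_cast hj.2
      refine hF _ _ (by positivity) ?_
      rw [Nat.cast_sub hj.2, abs_of_nonpos (by nlinarith)]
      nlinarith
  · -- grid points right of `x₀` (`m < j`): re-index by `k = j - (m + 1)`
    refine key _ (fun j => j - (m + 1)) ?_ ?_ ?_
    · intro j₁ hj₁ j₂ hj₂ he
      simp only [coe_filter, mem_range, Set.mem_setOf_eq] at hj₁ hj₂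
      simp only at he
      omega
    · intro j hj
      simp only [mem_filter, mem_range] at hj ⊢
      omega
    · intro j hj
      simp only [mem_filter, mem_range, not_le] at hj
      have hjm : (m : ℝ) + 1 ≤ j := by exact_mod_cast hj.2
      refine hF _ _ (by positivity) ?_
      rw [Nat.cast_sub (by omega), abs_of_nonneg (by nlinarith)]
      push_cast
      nlinarith

/-- `1/√(p² + t²) ≤ 2/(p + t)` for `p ≥ 0`, `t > 0`. [folklore] -/
theorem gs_one_div_sqrt_le {p t : ℝ} (hp : 0 ≤ p) (ht : 0 < t) :
    1 / Real.sqrt (p ^ 2 + t ^ 2) ≤ 2 / (p + t) := by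
  have hs : (p + t) / 2 ≤ Real.sqrt (p ^ 2 + t ^ 2) := by
    rw [Real.le_sqrt' (by positivity)]
    nlinarith [sq_nonneg (p - t)]
  calc 1 / Real.sqrt (p ^ 2 + t ^ 2) ≤ 1 / ((p + t) / 2) := one_div_le_one_div_of_le (by positivity) hs
    _ = 2 / (p + t) := one_div_div _ _

/-- Telescoping bound for the grid sum of `1/√(a²u² + t²)`:
`h Σ_{k<L} 1/√(a²(hk)² + t²) ≤ h/t + (2/a)(log(ahL + t) − log t)`. [folklore] -/
theorem gs_sum_inv_sqrt_le {a t h : ℝ} (ha : 0 < a) (ht : 0 < t) (hh : 0 < h) {L : ℕ} (hL : L ≠ 0) :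
    h * ∑ k ∈ range L, 1 / Real.sqrt (a ^ 2 * (h * k) ^ 2 + t ^ 2) ≤
      h / t + 2 / a * (Real.log (a * h * L + t) - Real.log t) := by
  obtain ⟨N, rfl⟩ := Nat.exists_eq_succ_of_ne_zero hL
  have h0 : h * (1 / Real.sqrt (a ^ 2 * (h * ((0 : ℕ) : ℝ)) ^ 2 + t ^ 2)) = h / t := by
    rw [Nat.cast_zero, mul_zero, zero_pow two_ne_zero, mul_zero, zero_add, Real.sqrt_sq ht.le,
      mul_one_div]
  have key : ∀ k ∈ range N, h * (1 / Real.sqrt (a ^ 2 * (h * ((k + 1 : ℕ) : ℝ)) ^ 2 + t ^ 2)) ≤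
      2 / a * (Real.log (a * h * ((k + 1 : ℕ) : ℝ) + t) - Real.log (a * h * (k : ℝ) + t)) := by
    intro k _
    push_cast
    have hp : 0 ≤ a * h * (k + 1) := by positivity
    have hY : 0 < a * h * k + t := by positivity
    have hX : 0 < a * h * (k + 1) + t := by positivity
    have hXne := hX.ne'
    have hYne := hY.ne'
    have hane := ha.ne'
    have e1 : a ^ 2 * (h * ((k : ℝ) + 1)) ^ 2 = (a * h * (k + 1)) ^ 2 := by ring
    have hlog : a * h / (a * h * (k + 1) + t) ≤
        Real.log (a * h * (k + 1) + t) - Real.log (a * h * k + t) := by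
      rw [← Real.log_div hXne hYne]
      refine le_trans (le_of_eq ?_) (Real.one_sub_inv_le_log_of_pos (div_pos hX hY))
      rw [inv_div, eq_sub_iff_add_eq, ← add_div, div_eq_one_iff_eq hXne]
      ring
    calc h * (1 / Real.sqrt (a ^ 2 * (h * ((k : ℝ) + 1)) ^ 2 + t ^ 2))
        ≤ h * (2 / (a * h * (k + 1) + t)) := by
          rw [e1]; exact mul_le_mul_of_nonneg_left (gs_one_div_sqrt_le hp ht) hh.le
      _ = 2 / a * (a * h / (a * h * (k + 1) + t)) := by
          field_simp
      _ ≤ 2 / a * (Real.log (a * h * (k + 1) + t) - Real.log (a * h * k + t)) :=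
          mul_le_mul_of_nonneg_left hlog (by positivity)
  have hmain : h * ∑ k ∈ range N, 1 / Real.sqrt (a ^ 2 * (h * ((k + 1 : ℕ) : ℝ)) ^ 2 + t ^ 2) ≤
      2 / a * (Real.log (a * h * ((N + 1 : ℕ) : ℝ) + t) - Real.log t) := by
    rw [mul_sum]
    calc ∑ k ∈ range N, h * (1 / Real.sqrt (a ^ 2 * (h * ((k + 1 : ℕ) : ℝ)) ^ 2 + t ^ 2))
        ≤ ∑ k ∈ range N, 2 / a *
            (Real.log (a * h * ((k + 1 : ℕ) : ℝ) + t) - Real.log (a * h * (k : ℝ) + t)) :=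
          sum_le_sum key
      _ = 2 / a * (Real.log (a * h * N + t) - Real.log t) := by
          rw [← mul_sum, Finset.sum_range_sub (fun k : ℕ => Real.log (a * h * (k : ℝ) + t)) N]
          simp
      _ ≤ 2 / a * (Real.log (a * h * ((N + 1 : ℕ) : ℝ) + t) - Real.log t) := by
          refine mul_le_mul_of_nonneg_left (sub_le_sub_right ?_ _) (by positivity)
          push_cast
          exact Real.log_le_log (by positivity) (by nlinarith [mul_pos ha hh])
  rw [sum_range_succ', mul_add, h0]
  linarith [hmain]

/-- Telescoping bound for the grid sum of `1/(a²u² + t²)`: `h Σ_{k<L} 1/(a²(hk)² + t²) ≤ h/t² + 2/(at)`.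
[folklore] -/
theorem gs_sum_inv_sq_le {a t h : ℝ} (ha : 0 < a) (ht : 0 < t) (hh : 0 < h) {L : ℕ} (hL : L ≠ 0) :
    h * ∑ k ∈ range L, 1 / (a ^ 2 * (h * k) ^ 2 + t ^ 2) ≤ h / t ^ 2 + 2 / (a * t) := by
  obtain ⟨N, rfl⟩ := Nat.exists_eq_succ_of_ne_zero hL
  have h0 : h * (1 / (a ^ 2 * (h * ((0 : ℕ) : ℝ)) ^ 2 + t ^ 2)) = h / t ^ 2 := by
    rw [Nat.cast_zero, mul_zero, zero_pow two_ne_zero, mul_zero, zero_add, mul_one_div]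
  have key : ∀ k ∈ range N, h * (1 / (a ^ 2 * (h * ((k + 1 : ℕ) : ℝ)) ^ 2 + t ^ 2)) ≤
      2 / a * (1 / (a * h * (k : ℝ) + t) - 1 / (a * h * ((k + 1 : ℕ) : ℝ) + t)) := by
    intro k _
    push_cast
    have hY : 0 < a * h * k + t := by positivity
    have hX : 0 < a * h * (k + 1) + t := by positivity
    have hD : 0 < a ^ 2 * (h * ((k : ℝ) + 1)) ^ 2 + t ^ 2 := by positivity
    have hXne := hX.ne'
    have hYne := hY.ne'
    have hane := ha.ne'
    have e : 2 / a * (1 / (a * h * k + t) - 1 / (a * h * (k + 1) + t)) =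
        2 * h / ((a * h * k + t) * (a * h * (k + 1) + t)) := by
      field_simp
      ring
    rw [e, mul_one_div, div_le_div_iff₀ hD (mul_pos hY hX)]
    have hYX : (a * h * k + t) * (a * h * (k + 1) + t) ≤
        2 * (a ^ 2 * (h * ((k : ℝ) + 1)) ^ 2 + t ^ 2) := by
      nlinarith [sq_nonneg (a * h * (k + 1) - t), mul_nonneg (mul_nonneg ha.le hh.le) hX.le]
    nlinarith [mul_le_mul_of_nonneg_left hYX hh.le]
  have hmain : h * ∑ k ∈ range N, 1 / (a ^ 2 * (h * ((k + 1 : ℕ) : ℝ)) ^ 2 + t ^ 2) ≤ 2 / (a * t) := by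
    rw [mul_sum]
    calc ∑ k ∈ range N, h * (1 / (a ^ 2 * (h * ((k + 1 : ℕ) : ℝ)) ^ 2 + t ^ 2))
        ≤ ∑ k ∈ range N, 2 / a * (1 / (a * h * (k : ℝ) + t) - 1 / (a * h * ((k + 1 : ℕ) : ℝ) + t)) :=
          sum_le_sum key
      _ = 2 / a * (1 / t - 1 / (a * h * N + t)) := by
          rw [← mul_sum, Finset.sum_range_sub' (fun k : ℕ => 1 / (a * h * (k : ℝ) + t)) N]
          simp
      _ ≤ 2 / a * (1 / t) := by
          refine mul_le_mul_of_nonneg_left ?_ (by positivity)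
          rw [sub_le_self_iff]
          positivity
      _ = 2 / (a * t) := by rw [mul_one_div, div_div]
  rw [sum_range_succ', mul_add, h0]
  linarith [hmain]

/-! ## The grid-sum bounds -/

/-- (S-3) **Grid-sum bounds** `GridSumBounds` (registered stub of line `Sketch`): for `μ ∈ (−4,4)`, `Δ₀ > 0`,
`t₀ ≥ 1` there is `C ≥ 0` with `(1/L)Σⱼ 1/ε(2πj/L) ≤ C(1 + |log t|)` and `(1/L)Σⱼ 1/ε(2πj/L)² ≤ C/t` for all
`L ≥ 4` and `t ∈ [1/L, t₀]` (`ε = lineEps μ Δ₀ t`). -/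
theorem stub_gridSumBounds : GridSumBounds := by
  intro μ hμ Δ₀ hΔ₀ t₀ ht₀
  obtain ⟨hμ1, hμ2⟩ := hμ
  have hπ := Real.pi_gt_three
  -- the node angle `n₀ = arccos(−μ/4) ∈ (0, π)` and the cone constant `κ`
  have hc1 : (-1 : ℝ) < -μ / 4 := by linarith
  have hc2 : -μ / 4 < 1 := by linarith
  obtain ⟨n₀, hn0, hnπ, hcos⟩ : ∃ n₀ : ℝ, 0 < n₀ ∧ n₀ < Real.pi ∧ Real.cos n₀ = -μ / 4 :=
    ⟨Real.arccos (-μ / 4), Real.arccos_pos.2 hc2, Real.arccos_lt_pi.2 hc1,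
      Real.cos_arccos hc1.le hc2.le⟩
  obtain ⟨κ, hκ, hκb⟩ := NodalDecay.abs_cos_sub_cos_ge hn0 hnπ
  -- constants
  have hm0 : 0 < min 1 Δ₀ := lt_min one_pos hΔ₀
  obtain ⟨a, ha0, ha⟩ : ∃ a : ℝ, 0 < a ∧ a = 2 * min 1 Δ₀ * κ := ⟨_, by positivity, rfl⟩
  obtain ⟨B, hB0, hB⟩ : ∃ B : ℝ, 0 ≤ B ∧ B = Real.log (2 * Real.pi * a + t₀) :=
    ⟨_, Real.log_nonneg (by nlinarith), rfl⟩
  refine ⟨2 * Real.pi + 2 / a * (B + 1), by positivity, ?_⟩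
  intro L _ hL t htL htt
  have hL0 : L ≠ 0 := by omega
  have hLpos : (0 : ℝ) < L := by exact_mod_cast Nat.pos_of_ne_zero hL0
  have ht : 0 < t := lt_of_lt_of_le (by positivity) htL
  -- the grid step `h = 2π/L`
  obtain ⟨h, hh0, hh⟩ : ∃ h : ℝ, 0 < h ∧ h = 2 * Real.pi / L := ⟨_, by positivity, rfl⟩
  have hhL : h * L = 2 * Real.pi := by rw [hh]; exact div_mul_cancel₀ _ hLpos.ne'
  have hht : h / t ≤ 2 * Real.pi := by
    have h1 : 1 ≤ t * L := by rwa [div_le_iff₀ hLpos] at htL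
    rw [div_le_iff₀ ht, hh, div_le_iff₀ hLpos]
    linarith [mul_nonneg (sub_nonneg.2 h1) Real.pi_pos.le]
  have hgrid : ∀ j : ℕ, 2 * Real.pi * (j : ℝ) / L = h * j := fun j => by rw [hh]; ring
  -- radicand lower bound from the cone inequality
  have hrad : ∀ θ : ℝ, |θ| ≤ Real.pi →
      a ^ 2 * (|θ| - n₀) ^ 2 + t ^ 2 ≤ coneSq Δ₀ * (Real.cos θ + μ / 4) ^ 2 + t ^ 2 := by
    intro θ hθ
    have h1 := hκb θ hθ
    have h2 : (κ * |(|θ| - n₀)|) ^ 2 ≤ (Real.cos θ - Real.cos n₀) ^ 2 := by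
      rw [← sq_abs (Real.cos θ - Real.cos n₀)]
      exact pow_le_pow_left₀ (by positivity) h1 2
    rw [mul_pow, sq_abs] at h2
    have h3 : Real.cos θ + μ / 4 = Real.cos θ - Real.cos n₀ := by rw [hcos]; ring
    have h4 : coneSq Δ₀ * κ ^ 2 * (|θ| - n₀) ^ 2 ≤ coneSq Δ₀ * (Real.cos θ - Real.cos n₀) ^ 2 := by
      rw [mul_assoc]; exact mul_le_mul_of_nonneg_left h2 (by unfold coneSq; positivity)
    have h5 : a ^ 2 ≤ coneSq Δ₀ * κ ^ 2 := by
      rw [ha]; unfold coneSq; linarith [sq_nonneg (min 1 Δ₀ * κ)]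
    rw [h3]
    linarith [mul_le_mul_of_nonneg_right h5 (sq_nonneg (|θ| - n₀))]
  -- the two comparison functions `f(u) = 1/√(a²u² + t²)`, `g(u) = 1/(a²u² + t²)`
  obtain ⟨f, hf⟩ : ∃ f : ℝ → ℝ, ∀ u, f u = 1 / Real.sqrt (a ^ 2 * u ^ 2 + t ^ 2) := ⟨_, fun _ => rfl⟩
  obtain ⟨g, hg⟩ : ∃ g : ℝ → ℝ, ∀ u, g u = 1 / (a ^ 2 * u ^ 2 + t ^ 2) := ⟨_, fun _ => rfl⟩
  have hf0 : ∀ u, 0 ≤ f u := fun u => by rw [hf]; positivity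
  have hg0 : ∀ u, 0 ≤ g u := fun u => by rw [hg]; positivity
  have hsq : ∀ u v : ℝ, 0 ≤ u → u ≤ |v| → a ^ 2 * u ^ 2 + t ^ 2 ≤ a ^ 2 * v ^ 2 + t ^ 2 := by
    intro u v hu huv
    have : u ^ 2 ≤ v ^ 2 := by rw [← sq_abs v]; exact pow_le_pow_left₀ hu huv 2
    linarith [mul_le_mul_of_nonneg_left this (sq_nonneg a)]
  have hfm : ∀ u v, 0 ≤ u → u ≤ |v| → f v ≤ f u := fun u v hu huv => by
    rw [hf, hf]
    exact one_div_le_one_div_of_le (Real.sqrt_pos.2 (by positivity))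
      (Real.sqrt_le_sqrt (hsq u v hu huv))
  have hgm : ∀ u v, 0 ≤ u → u ≤ |v| → g v ≤ g u := fun u v hu huv => by
    rw [hg, hg]
    exact one_div_le_one_div_of_le (by positivity) (hsq u v hu huv)
  -- pointwise comparison at the grid points `θ_j = hj ∈ [0, 2π)`
  have hpt : ∀ j : ℕ, j < L →
      1 / lineEps μ Δ₀ t (h * j) ≤ f (h * j - n₀) + f (h * j - (2 * Real.pi - n₀)) ∧
      1 / lineEps μ Δ₀ t (h * j) ^ 2 ≤ g (h * j - n₀) + g (h * j - (2 * Real.pi - n₀)) := by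
    intro j hj
    have hj0 : 0 ≤ h * j := by positivity
    have hj2 : h * j < 2 * Real.pi := by
      rw [← hhL]; exact mul_lt_mul_of_pos_left (by exact_mod_cast hj) hh0
    have step : ∀ x : ℝ, a ^ 2 * x ^ 2 + t ^ 2 ≤ coneSq Δ₀ * (Real.cos (h * j) + μ / 4) ^ 2 + t ^ 2 →
        1 / lineEps μ Δ₀ t (h * j) ≤ f x ∧ 1 / lineEps μ Δ₀ t (h * j) ^ 2 ≤ g x := by
      intro x hx
      have hpos : 0 < a ^ 2 * x ^ 2 + t ^ 2 := by positivity
      rw [hf, hg]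
      unfold lineEps
      refine ⟨one_div_le_one_div_of_le (Real.sqrt_pos.2 hpos) (Real.sqrt_le_sqrt hx), ?_⟩
      rw [Real.sq_sqrt (hpos.le.trans hx)]
      exact one_div_le_one_div_of_le hpos hx
    rcases le_or_gt (h * j) Real.pi with hle | hlt
    · have hr := hrad (h * j) (by rwa [abs_of_nonneg hj0])
      rw [abs_of_nonneg hj0] at hr
      obtain ⟨b1, b2⟩ := step _ hr
      exact ⟨b1.trans (le_add_of_nonneg_right (hf0 _)), b2.trans (le_add_of_nonneg_right (hg0 _))⟩
    · have habs : |h * j - 2 * Real.pi| = 2 * Real.pi - h * j := by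
        rw [abs_sub_comm]; exact abs_of_nonneg (by linarith)
      have hr := hrad (h * j - 2 * Real.pi) (by rw [habs]; linarith)
      rw [habs, Real.cos_sub_two_pi] at hr
      have e : (2 * Real.pi - h * j - n₀) ^ 2 = (h * j - (2 * Real.pi - n₀)) ^ 2 := by ring
      rw [e] at hr
      obtain ⟨b1, b2⟩ := step _ hr
      exact ⟨b1.trans (le_add_of_nonneg_left (hf0 _)), b2.trans (le_add_of_nonneg_left (hg0 _))⟩
  -- the two centres lie in `[0, hL)`
  have hx1 : n₀ < h * L := by rw [hhL]; linarith
  have hx2 : 2 * Real.pi - n₀ < h * L := by rw [hhL]; linarith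
  have hx2' : 0 ≤ 2 * Real.pi - n₀ := by linarith
  -- telescoping bounds
  have hTf : h * ∑ k ∈ range L, f (h * k) ≤ h / t + 2 / a * (Real.log (a * h * L + t) - Real.log t) := by
    simp only [hf]; exact gs_sum_inv_sqrt_le ha0 ht hh0 hL0
  have hTg : h * ∑ k ∈ range L, g (h * k) ≤ h / t ^ 2 + 2 / (a * t) := by
    simp only [hg]; exact gs_sum_inv_sq_le ha0 ht hh0 hL0
  have hlog : Real.log (a * h * L + t) - Real.log t ≤ B + |Real.log t| := by
    have h1 : Real.log (a * h * L + t) ≤ B := by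
      rw [hB]
      apply Real.log_le_log (by positivity)
      rw [mul_assoc, hhL]; linarith
    have h2 := neg_abs_le (Real.log t)
    linarith
  have h4π : (4 : ℝ) ≤ 2 * Real.pi := by linarith
  have hc : 0 ≤ 2 / a := by positivity
  have hl : 0 ≤ |Real.log t| := abs_nonneg _
  -- convert the `Fin L` sums to sums over `range L`
  rw [Fin.sum_univ_eq_sum_range (fun j : ℕ => 1 / lineEps μ Δ₀ t (2 * Real.pi * (j : ℝ) / L)) L,
    Fin.sum_univ_eq_sum_range (fun j : ℕ => 1 / lineEps μ Δ₀ t (2 * Real.pi * (j : ℝ) / L) ^ 2) L]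
  constructor
  · -- first bound: `(1/L) Σ 1/ε ≤ C (1 + |log t|)`
    have hS : ∑ j ∈ range L, 1 / lineEps μ Δ₀ t (2 * Real.pi * (j : ℝ) / L) ≤
        4 * ∑ k ∈ range L, f (h * k) := by
      calc ∑ j ∈ range L, 1 / lineEps μ Δ₀ t (2 * Real.pi * (j : ℝ) / L)
          ≤ ∑ j ∈ range L, (f (h * j - n₀) + f (h * j - (2 * Real.pi - n₀))) := by
            refine sum_le_sum fun j hj => ?_
            rw [hgrid]; exact (hpt j (mem_range.1 hj)).1
        _ = ∑ j ∈ range L, f (h * j - n₀) + ∑ j ∈ range L, f (h * j - (2 * Real.pi - n₀)) :=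
            sum_add_distrib
        _ ≤ 2 * ∑ k ∈ range L, f (h * k) + 2 * ∑ k ∈ range L, f (h * k) :=
            add_le_add (gs_sum_shift_le f hf0 hfm hh0 hn0.le L hx1)
              (gs_sum_shift_le f hf0 hfm hh0 hx2' L hx2)
        _ = 4 * ∑ k ∈ range L, f (h * k) := by ring
    have hSf0 : 0 ≤ ∑ k ∈ range L, f (h * k) := sum_nonneg fun k _ => hf0 _
    calc 1 / (L : ℝ) * ∑ j ∈ range L, 1 / lineEps μ Δ₀ t (2 * Real.pi * (j : ℝ) / L)
        ≤ 1 / (L : ℝ) * (4 * ∑ k ∈ range L, f (h * k)) :=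
          mul_le_mul_of_nonneg_left hS (by positivity)
      _ ≤ 1 / (L : ℝ) * (2 * Real.pi * ∑ k ∈ range L, f (h * k)) :=
          mul_le_mul_of_nonneg_left (mul_le_mul_of_nonneg_right h4π hSf0) (by positivity)
      _ = h * ∑ k ∈ range L, f (h * k) := by rw [hh]; ring
      _ ≤ h / t + 2 / a * (Real.log (a * h * L + t) - Real.log t) := hTf
      _ ≤ 2 * Real.pi + 2 / a * (B + |Real.log t|) :=
          add_le_add hht (mul_le_mul_of_nonneg_left hlog hc)
      _ ≤ (2 * Real.pi + 2 / a * (B + 1)) * (1 + |Real.log t|) := by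
          linarith [mul_nonneg hc hl, mul_nonneg (mul_nonneg hc hB0) hl, mul_nonneg Real.pi_pos.le hl]
  · -- second bound: `(1/L) Σ 1/ε² ≤ C/t`
    have hS : ∑ j ∈ range L, 1 / lineEps μ Δ₀ t (2 * Real.pi * (j : ℝ) / L) ^ 2 ≤
        4 * ∑ k ∈ range L, g (h * k) := by
      calc ∑ j ∈ range L, 1 / lineEps μ Δ₀ t (2 * Real.pi * (j : ℝ) / L) ^ 2
          ≤ ∑ j ∈ range L, (g (h * j - n₀) + g (h * j - (2 * Real.pi - n₀))) := by
            refine sum_le_sum fun j hj => ?_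
            rw [hgrid]; exact (hpt j (mem_range.1 hj)).2
        _ = ∑ j ∈ range L, g (h * j - n₀) + ∑ j ∈ range L, g (h * j - (2 * Real.pi - n₀)) :=
            sum_add_distrib
        _ ≤ 2 * ∑ k ∈ range L, g (h * k) + 2 * ∑ k ∈ range L, g (h * k) :=
            add_le_add (gs_sum_shift_le g hg0 hgm hh0 hn0.le L hx1)
              (gs_sum_shift_le g hg0 hgm hh0 hx2' L hx2)
        _ = 4 * ∑ k ∈ range L, g (h * k) := by ring
    have hSg0 : 0 ≤ ∑ k ∈ range L, g (h * k) := sum_nonneg fun k _ => hg0 _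
    have hdiv : h / t ^ 2 ≤ 2 * Real.pi / t := by
      rw [pow_two, ← div_div]; exact div_le_div_of_nonneg_right hht ht.le
    calc 1 / (L : ℝ) * ∑ j ∈ range L, 1 / lineEps μ Δ₀ t (2 * Real.pi * (j : ℝ) / L) ^ 2
        ≤ 1 / (L : ℝ) * (4 * ∑ k ∈ range L, g (h * k)) :=
          mul_le_mul_of_nonneg_left hS (by positivity)
      _ ≤ 1 / (L : ℝ) * (2 * Real.pi * ∑ k ∈ range L, g (h * k)) :=
          mul_le_mul_of_nonneg_left (mul_le_mul_of_nonneg_right h4π hSg0) (by positivity)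
      _ = h * ∑ k ∈ range L, g (h * k) := by rw [hh]; ring
      _ ≤ h / t ^ 2 + 2 / (a * t) := hTg
      _ ≤ 2 * Real.pi / t + 2 / (a * t) := by linarith [hdiv]
      _ = (2 * Real.pi + 2 / a) / t := by rw [add_div, div_div]
      _ ≤ (2 * Real.pi + 2 / a * (B + 1)) / t := by
          refine div_le_div_of_nonneg_right ?_ ht.le
          linarith [mul_nonneg hc hB0]

end Summit.HubbardSuperconductivity.HubbardSuperconductivity.Theorems.VisonPairCost

end
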